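import Mathlib.Topology.MetricSpace.HausdorffDimension
import Literature.Analysis.FluidPDE.EulerReynolds
import Literature.Analysis.FluidPDE.LerayHopf
import HarnessLib

/-!
# The Navier–Stokes–Reynolds system on `T^d` and the Cheskidov–Luo iteration vocabulary

The *Navier–Stokes–Reynolds system* is the viscous twin of the Euler–Reynolds system
(`Torus.IsEulerReynoldsOn`, `Literature.Analysis.FluidPDE.EulerReynolds`): a smooth triple
`(u, p, R)` of a velocity, a pressure and a symmetric trace-free `2`-tensor (the *Reynolds
stress*) on `T^d × S` with

  `∂ₜ u - ν Δu + div (u ⊗ u) + ∇p = div R`,  `div u = 0`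

(Cheskidov–Luo 2022, §2.1, system (2.1) with `ν = 1`: "`R : [0,T] × 𝕋^d → 𝒮₀^{d×d}` is a
traceless symmetric matrix called Reynolds stress"; Buckmaster–Vicol 2019, §2, (2.1)). It is the
system of approximate solutions in every convex-integration scheme for Navier–Stokes; when
`R = 0` on a time set the triple is a classical Navier–Stokes solution there.

This file vendors the vocabulary of the iteration behind the sharp `L^p_t L^∞_x` non-uniqueness
theorem of A. Cheskidov, X. Luo, *Sharp nonuniqueness for the Navier–Stokes equations*, Invent.
Math. 229 (2022) 987–1054 = arXiv:2009.06596 (numbering of the held arXiv copy), whose Thm. 1.7 is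
the accepted named fact `Literature.Barriers.NavierStokesRegularity.CheskidovLuo2022MainTheorem`:

* `Torus.IsNSReynoldsOn S ν u p R` (structure, exactly the fields of `Torus.IsEulerReynoldsOn`
  with the viscous term; `isNSReynoldsOn_zero_iff`: `ν = 0` is Euler–Reynolds), with the proved
  sanity lemmas `Torus.isNSReynoldsOn_zero`, `IsNSReynoldsOn.mono_Icc`,
  `IsNSReynoldsOn.isClassicalNSSolutionOn_of_stress_eq_zero` (where `R = 0` the pair `(u, p)` is
  a classical unforced Navier–Stokes solution, accepted `Torus.IsClassicalNSSolutionOn`), and the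
  **weak identity with datum and Reynolds defect** `IsNSReynoldsOn.weak_identity` (proved): for
  every smooth divergence-free test field `ψ` on `[0, T)` (accepted `Torus.IsSpaceTimeTest`,
  possibly `ψ(0) ≠ 0`),
  `∫₀ᵀ∫ (⟪u, ∂ₜψ⟫ + ⟪u, (u·∇)ψ⟫ + ν⟪u, Δψ⟫) + ∫ ⟪u(0), ψ(0)⟫ = ∫₀ᵀ∫ ∑ⱼ ⟪R^{(j)}, ∂ⱼψ⟫`
  — the identity "using weak formulation of (2.1) or integrating by parts" in the proof of
  Thm. 1.7 (CL22, §2.6), i.e. the accepted `Torus.IsWeakNSSolutionWithDataOn` identity up to the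
  defect `-∫∫ R : ∇ψ`.
* `Torus.IsWellPrepared T ε R I τ` — CL22, Def. 2.1 ("well-preparedness": `I` is a union of at
  most `τ^{-ε}` closed intervals of length `5τ` and `R(t) = 0` whenever `dist (t, Iᶜ) ≤ τ`),
  printed for `T = 1` and rendered on `[0, T]` with the interval count normalised by `T`
  (`card ≤ (T/τ)^ε`, verbatim at `T = 1`; see the docstring); `Torus.isWellPrepared_Icc`: the
  vacuous configuration `I = [-2T, 3T]`, `τ = T` that starts the iteration.
* the named facts (not proved here; `def … : Prop`)
  `Torus.exists_smooth_antidivergence` (the tensor-valued antidivergence `ℛ` of De Lellis–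
  Székelyhidi, CL22 §7.2 = App. B, Def. 7.2: `div ℛ v = v - ⨍ v`, `ℛ v` symmetric and trace
  free, here for jointly smooth time-dependent fields) and
  `Torus.CheskidovLuo2022MainIteration` (CL22, Prop. 2.2, the main iteration, in the form its
  proof delivers — see its docstring for the two places where the printed wording is corrected
  from §§3–5 of the same paper);
* `dimH_le_of_finset_Icc_covers` (proved): a set of reals which, along a sequence `ℓₙ → 0`, is
  covered by at most `A ℓₙ^{-ε}` intervals of length `ℓₙ` has Hausdorff dimension `≤ ε` — the last
  step of the proof of Thm. 1.7 (CL22, §2.6: "each `𝓑ₙ` is covered by at most `τₙ^{-ε}` many balls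
  of radius `5τₙ`, so `d_𝓗(limsup 𝓑ₙ) ≤ ε`"), from Mathlib's `hausdorffMeasure_le_liminf_sum`.

## Design notes

* The stress is stored by columns, `R t x j ∈ ℝ^d`, exactly as in `Torus.IsEulerReynoldsOn`
  (pointwise norm = maximal Euclidean column norm; CL22 do not fix a matrix norm, all are
  equivalent up to dimensional constants, which the constants `M`, `r`, `δ` of Prop. 2.2 absorb).
* Zero spatial mean of the velocity (CL22's standing convention, §1.1 and §1.7: all fields lie in
  `C₀^∞`) is **not** a field of `IsNSReynoldsOn` (as for `Torus.IsClassicalNSSolutionOn`); the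
  iteration fact carries it as an explicit hypothesis and conclusion.
* Mixed norms are the accepted `Torus.eLqLpNorm q p u S` (`L^q_t L^p_x`, Serrin 1963 §3); in
  particular `‖w‖_{L²([0,T] × 𝕋^d)} = Torus.eLqLpNorm 2 2 w (Ioo 0 T)`.

## Mathlib search

Mathlib (this pin) has no Navier–Stokes/Reynolds-stress notions (searched `Reynolds`,
`NavierStokes`: none outside this library); used: `dimH`, `dimH_le`,
`MeasureTheory.Measure.hausdorffMeasure_le_liminf_sum`, `Real.ediam_Icc`, `Metric.infDist`.

## References

* A. Cheskidov, X. Luo, *Sharp nonuniqueness for the Navier–Stokes equations*, Invent. Math. 229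
  (2022), 987–1054; arXiv:2009.06596: §2.1 (2.1), Def. 2.1, Prop. 2.2, §2.6, Prop. 3.1,
  Prop. 4.1, Props. 5.3–5.5, §7.2 Def. 7.2. [`CheskidovLuo2022`]
* T. Buckmaster, V. Vicol, *Nonuniqueness of weak solutions to the Navier–Stokes equation*, Ann.
  of Math. 189 (2019), §2 (Navier–Stokes–Reynolds system). [`BuckmasterVicol2019`]
* T. Buckmaster, C. De Lellis, L. Székelyhidi Jr., V. Vicol, *Onsager's conjecture for admissible
  weak solutions*, CPAM 72 (2019), §2.1. [`BuckmasterEtAl2018`]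
-/

open MeasureTheory Set Topology Filter
open scoped InnerProductSpace ContDiff ENNReal NNReal

noncomputable section

namespace Literature.Analysis.FluidPDE

namespace Torus

variable {d : Type*} [Fintype d] [DecidableEq d]

/-! ## Classical solutions of the Navier–Stokes–Reynolds system -/

section NSR

/-- Smooth (classical) solutions of the **Navier–Stokes–Reynolds system** with viscosity `ν` on
`T^d × S`, `S ⊆ ℝ` a time set (Cheskidov–Luo 2022, §2.1, (2.1), `ν = 1`; Buckmaster–Vicol 2019,
§2): a velocity `u`, a pressure `p` and a Reynolds stress `R` (a `2`-tensor field stored by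
columns, `R t x j ∈ ℝ^d`), all jointly `C^∞` on `S × T^d`, with
`∂ₜu + (u·∇)u + ∇p = ν Δu + div R`, `div u = 0`, `R` symmetric and trace free ("traceless
symmetric matrix called Reynolds stress"), and `p` of zero mean at every time of `S` (the
pressure is determined by `Δp = div div (R - u ⊗ u)` up to this normalisation, CL22 §2.1). For
divergence-free `u`, `(u·∇)u = div (u ⊗ u)`. The time derivative is the one-sided
`Torus.timeDerivWithin S`. Exactly the fields of `Torus.IsEulerReynoldsOn` plus the viscous term
(`isNSReynoldsOn_zero_iff`). [cite: CheskidovLuo2022, §2.1 (2.1)] -/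
structure IsNSReynoldsOn (S : Set ℝ) (ν : ℝ) (u : ℝ → UnitAddTorus d → EuclideanSpace ℝ d)
    (p : ℝ → UnitAddTorus d → ℝ) (R : ℝ → UnitAddTorus d → d → EuclideanSpace ℝ d) : Prop where
  /-- The velocity is jointly smooth on `S × T^d`. -/
  smooth_velocity : FunctionSpaces.Torus.IsSmoothSpaceTimeOn S u
  /-- The pressure is jointly smooth on `S × T^d`. -/
  smooth_pressure : FunctionSpaces.Torus.IsSmoothSpaceTimeOn S p
  /-- The Reynolds stress is jointly smooth on `S × T^d`. -/
  smooth_stress : FunctionSpaces.Torus.IsSmoothSpaceTimeOn S R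
  /-- The momentum equation `∂ₜu + (u·∇)u + ∇p = ν Δu + div R` holds pointwise on `S × T^d`. -/
  momentum : ∀ t ∈ S, ∀ x,
    FunctionSpaces.Torus.timeDerivWithin S u t x + FunctionSpaces.Torus.convect (u t) (u t) x + FunctionSpaces.Torus.gradient (p t) x =
      ν • FunctionSpaces.Torus.laplacian (u t) x + tensorDivergence (R t) x
  /-- Incompressibility `div u(t) = 0` for `t ∈ S`. -/
  divFree : ∀ t ∈ S, FunctionSpaces.Torus.IsDivFree (u t)
  /-- The Reynolds stress is symmetric. -/
  symm : ∀ t ∈ S, ∀ x, ∀ i j : d, R t x i j = R t x j i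
  /-- The Reynolds stress is trace free, `tr R = 0`. -/
  traceFree : ∀ t ∈ S, ∀ x, ∑ i, R t x i i = 0
  /-- The pressure has zero mean, `∫ p(t) = 0`. -/
  hasZeroMean_pressure : ∀ t ∈ S, FunctionSpaces.Torus.HasZeroMean (p t)

variable {S : Set ℝ} {T ν : ℝ} {u : ℝ → UnitAddTorus d → EuclideanSpace ℝ d}
  {p : ℝ → UnitAddTorus d → ℝ} {R : ℝ → UnitAddTorus d → d → EuclideanSpace ℝ d}

/-- At viscosity `ν = 0` the Navier–Stokes–Reynolds system is the Euler–Reynolds system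
(CL22, §2.1: "in the inviscid case, we can just drop the Laplacian term … the system becomes the
so-called Euler–Reynolds equations"). [cite: CheskidovLuo2022, §2.1] -/
theorem isNSReynoldsOn_zero_iff : IsNSReynoldsOn S 0 u p R ↔ IsEulerReynoldsOn S u p R := by
  constructor
  · intro h
    exact ⟨h.smooth_velocity, h.smooth_pressure, h.smooth_stress,
      fun t ht x => by simpa using h.momentum t ht x, h.divFree, h.symm, h.traceFree,
      h.hasZeroMean_pressure⟩
  · intro h
    exact ⟨h.smooth_velocity, h.smooth_pressure, h.smooth_stress,
      fun t ht x => by simpa using h.momentum t ht x, h.divFree, h.symm, h.traceFree,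
      h.hasZeroMean_pressure⟩

omit [DecidableEq d] in
/-- The Laplacian of the zero field vanishes. [folklore] -/
@[simp]
theorem laplacian_zero_field (x : UnitAddTorus d) :
    FunctionSpaces.Torus.laplacian (fun _ : UnitAddTorus d => (0 : EuclideanSpace ℝ d)) x = 0 := by
  unfold FunctionSpaces.Torus.laplacian FunctionSpaces.Torus.liftAt
  simp

/-- The zero triple `(u, p, R) = (0, 0, 0)` solves the Navier–Stokes–Reynolds system on every
time set and for every viscosity. [folklore] -/
theorem isNSReynoldsOn_zero (S : Set ℝ) (ν : ℝ) :
    IsNSReynoldsOn (d := d) S ν (fun _ _ => 0) (fun _ _ => 0) (fun _ _ _ => 0) where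
  smooth_velocity := contDiffOn_const
  smooth_pressure := contDiffOn_const
  smooth_stress := contDiffOn_const
  momentum t _ x := by simp
  divFree t _ x := by simp
  symm _ _ _ _ _ := rfl
  traceFree _ _ _ := by simp
  hasZeroMean_pressure _ _ := by simp [FunctionSpaces.Torus.HasZeroMean]

/-- A Navier–Stokes–Reynolds solution on `S` is one on every interval `[0, T] ⊆ S` with `0 < T`
(one-sided time derivatives within `[0, T]` and within `S` agree on `[0, T]`). [folklore] -/
theorem IsNSReynoldsOn.mono_Icc (h : IsNSReynoldsOn S ν u p R) (hS : Icc 0 T ⊆ S)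
    (hT : 0 < T) : IsNSReynoldsOn (Icc 0 T) ν u p R where
  smooth_velocity := h.smooth_velocity.mono hS
  smooth_pressure := h.smooth_pressure.mono hS
  smooth_stress := h.smooth_stress.mono hS
  momentum t ht x := by
    have h1 : FunctionSpaces.Torus.timeDerivWithin (Icc 0 T) u t x = FunctionSpaces.Torus.timeDerivWithin S u t x := by
      have hd : HasDerivWithinAt (fun τ => u τ x) (FunctionSpaces.Torus.timeDerivWithin S u t x) (Icc 0 T) t :=
        ((h.smooth_velocity.hasDerivWithinAt_slice (hS ht) x)).mono hS
      exact hd.derivWithin (uniqueDiffOn_Icc hT t ht)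
    rw [h1]
    exact h.momentum t (hS ht) x
  divFree t ht := h.divFree t (hS ht)
  symm t ht := h.symm t (hS ht)
  traceFree t ht := h.traceFree t (hS ht)
  hasZeroMean_pressure t ht := h.hasZeroMean_pressure t (hS ht)

/-- **Where the stress vanishes, a Navier–Stokes–Reynolds solution is a classical Navier–Stokes
solution.** If `(u, p, R)` solves the system on `S` and `R = 0` on a subset `S' ⊆ S` of unique
differentiability (e.g. a non-trivial interval), then `(u, p)` is a classical solution of the
unforced Navier–Stokes system on `T^d × S'` (accepted `Torus.IsClassicalNSSolutionOn`; CL22,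
Rem. 2.3 (3): "on large portions of the time axis, the solutions are exact solutions of the
Navier–Stokes equations"). [cite: CheskidovLuo2022, Rem. 2.3] -/
theorem IsNSReynoldsOn.isClassicalNSSolutionOn_of_stress_eq_zero (h : IsNSReynoldsOn S ν u p R)
    {S' : Set ℝ} (hS' : S' ⊆ S) (hU : UniqueDiffOn ℝ S') (hR : ∀ t ∈ S', ∀ x, R t x = 0) :
    FunctionSpaces.Torus.IsClassicalNSSolutionOn S' ν 0 u p where
  smooth_velocity := h.smooth_velocity.mono hS'
  smooth_pressure := h.smooth_pressure.mono hS'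
  momentum t ht x := by
    have h1 : FunctionSpaces.Torus.timeDerivWithin S' u t x = FunctionSpaces.Torus.timeDerivWithin S u t x := by
      have hd : HasDerivWithinAt (fun τ => u τ x) (FunctionSpaces.Torus.timeDerivWithin S u t x) S' t :=
        ((h.smooth_velocity.hasDerivWithinAt_slice (hS' ht) x)).mono hS'
      exact hd.derivWithin (hU t ht)
    have hR0 : R t = fun _ _ => 0 := by
      funext y j
      rw [hR t ht y]
      rfl
    have hm := h.momentum t (hS' ht) x
    rw [hR0, tensorDivergence_zero, add_zero] at hm
    rw [h1]
    simp only [Pi.zero_apply, add_zero]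
    rw [eq_sub_iff_add_eq, hm]
  divFree t ht := h.divFree t (hS' ht)

/-- **The weak identity with datum and Reynolds defect.** For a classical solution of the
Navier–Stokes–Reynolds system on a time set `S ⊇ [0, T]`, `T > 0`, and every smooth
divergence-free test field `ψ` on `[0, T)` (accepted `Torus.IsSpaceTimeTest`: smooth on
`ℝ × ℝ^d`, vanishing for `t ≥ T'` for some `T' < T`, possibly `ψ(0) ≠ 0`),
`∫₀ᵀ ∫ (⟪u, ∂ₜψ⟫ + ⟪u, (u·∇)ψ⟫ + ν ⟪u, Δψ⟫) dx dt + ∫ ⟪u(0), ψ(0)⟫ dx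
  = ∫₀ᵀ ∫ ∑ⱼ ⟪R^{(j)}, ∂ⱼψ⟫ dx dt`,
i.e. `u` satisfies the identity of the accepted `Torus.IsWeakNSSolutionWithDataOn T ν (u 0)` up
to the Reynolds defect `-∫∫ R : ∇ψ` on the right (CL22, §2.6, proof of Thm. 1.7: "using weak
formulation of (2.1) or integrating by parts we have
`∫ uₙ(0)·φ(0) = -∫∫ (uₙ·Δφ + uₙ ⊗ uₙ : ∇φ + uₙ·∂ₜφ) - ∫∫ Rₙ : ∇φ`"). Proof, as for
`Torus.IsEulerReynoldsOn.weak_identity`: `E(t) = ∫ ⟪u(t), ψ(t)⟫` has `E(T) = 0`,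
`E(0) = ∫ ⟪u(0), ψ(0)⟫`, and within `[0, T]`
`E' = ∫ (⟪u, ∂ₜψ⟫ + ⟪νΔu + div R - ∇p - (u·∇)u, ψ⟫)`; on the torus `∫ ⟪Δu, ψ⟫ = ∫ ⟪u, Δψ⟫`,
`∫ ⟪∇p, ψ⟫ = 0`, `∫ ⟪(u·∇)u, ψ⟫ = -∫ ⟪u, (u·∇)ψ⟫`, `∫ ⟪div R, ψ⟫ = -∫ ∑ⱼ ⟪R^{(j)}, ∂ⱼψ⟫`,
and `∫₀ᵀ E' = E(T) - E(0)`. [cite: CheskidovLuo2022, §2.6 (proof of Thm. 1.7)] -/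
theorem IsNSReynoldsOn.weak_identity (h : IsNSReynoldsOn S ν u p R) (hS : Icc 0 T ⊆ S)
    (hT : 0 < T) {ψ : ℝ → UnitAddTorus d → EuclideanSpace ℝ d} (hψ : FunctionSpaces.Torus.IsSpaceTimeTest T ψ)
    (hψdiv : FunctionSpaces.Torus.IsDivFreeTest ψ) :
    (∫ t in Ioo 0 T, ∫ x, (⟪u t x, FunctionSpaces.Torus.timeDeriv ψ t x⟫_ℝ + ⟪u t x, FunctionSpaces.Torus.convect (u t) (ψ t) x⟫_ℝ +
        ν * ⟪u t x, FunctionSpaces.Torus.laplacian (ψ t) x⟫_ℝ)) + ∫ x, ⟪u 0 x, ψ 0 x⟫_ℝ =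
      ∫ t in Ioo 0 T, ∫ x, ∑ j, ⟪R t x j, FunctionSpaces.Torus.partialDeriv j (ψ t) x⟫_ℝ := by
  -- restrict to the time interval `I = [0, T]`
  have hI := h.mono_Icc hS hT
  obtain ⟨hψs, T', hT'T, hT'⟩ := id hψ
  set I : Set ℝ := Icc 0 T with hI_def
  have hU : UniqueDiffOn ℝ I := uniqueDiffOn_Icc hT
  have hv : FunctionSpaces.Torus.IsSmoothSpaceTimeOn I u := hI.smooth_velocity
  have hp : FunctionSpaces.Torus.IsSmoothSpaceTimeOn I p := hI.smooth_pressure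
  have hR : FunctionSpaces.Torus.IsSmoothSpaceTimeOn I R := hI.smooth_stress
  have hψI : FunctionSpaces.Torus.IsSmoothSpaceTimeOn I ψ := hψs.contDiffOn
  have hψ'I : FunctionSpaces.Torus.IsSmoothSpaceTimeOn I (FunctionSpaces.Torus.timeDeriv ψ) := hψ.timeDeriv.1.contDiffOn
  -- the pairing `E(t) = ∫ ⟪u(t), ψ(t)⟫` and its derivative within `I`
  have hg : FunctionSpaces.Torus.IsSmoothSpaceTimeOn I (fun t x => ⟪u t x, ψ t x⟫_ℝ) := hv.inner hψI
  set E : ℝ → ℝ := fun t => ∫ x, ⟪u t x, ψ t x⟫_ℝ with hE_def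
  set E' : ℝ → ℝ := fun t => ∫ x, FunctionSpaces.Torus.timeDerivWithin I (fun t x => ⟪u t x, ψ t x⟫_ℝ) t x
    with hE'_def
  have hE : ∀ t ∈ I, HasDerivWithinAt E (E' t) I t := fun t ht =>
    hg.hasDerivWithinAt_integral (convex_Icc 0 T) ht
  have hE'cont : ContinuousOn E' I := hg.continuousOn_integral_timeDerivWithin hU
  have hET : E T = 0 := by
    simp only [hE_def, hT' T hT'T.le, Pi.zero_apply, inner_zero_right, integral_zero]
  have hFTC : ∫ t in Ioo 0 T, E' t = -E 0 := by
    rw [← integral_Ioc_eq_integral_Ioo, ← intervalIntegral.integral_of_le hT.le,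
      intervalIntegral.integral_eq_sub_of_hasDerivAt_of_le hT.le
        (fun t ht => (hE t ht).continuousWithinAt)
        (fun t ht => (hE t (Ioo_subset_Icc_self ht)).hasDerivAt (Icc_mem_nhds ht.1 ht.2))
        ((hE'cont.mono (uIcc_of_le hT.le).subset).intervalIntegrable),
      hET, zero_sub]
  -- the two space-integrated sides, continuous in time on `I`
  set A : ℝ → ℝ := fun t =>
    ∫ x, (⟪u t x, FunctionSpaces.Torus.timeDeriv ψ t x⟫_ℝ + ⟪u t x, FunctionSpaces.Torus.convect (u t) (ψ t) x⟫_ℝ +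
      ν * ⟪u t x, FunctionSpaces.Torus.laplacian (ψ t) x⟫_ℝ) with hA_def
  set B : ℝ → ℝ := fun t => ∫ x, ∑ j, ⟪R t x j, FunctionSpaces.Torus.partialDeriv j (ψ t) x⟫_ℝ with hB_def
  have hAsm : FunctionSpaces.Torus.IsSmoothSpaceTimeOn I
      (fun t x => ⟪u t x, FunctionSpaces.Torus.timeDeriv ψ t x⟫_ℝ + ⟪u t x, FunctionSpaces.Torus.convect (u t) (ψ t) x⟫_ℝ +
        ν * ⟪u t x, FunctionSpaces.Torus.laplacian (ψ t) x⟫_ℝ) :=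
    ((hv.inner hψ'I).add (hv.inner (hv.convect hψI hU))).add
      ((hv.inner (hψI.laplacian hU)).const_smul ν)
  have hBsm : FunctionSpaces.Torus.IsSmoothSpaceTimeOn I (fun t x => ∑ j, ⟪R t x j, FunctionSpaces.Torus.partialDeriv j (ψ t) x⟫_ℝ) :=
    FunctionSpaces.Torus.IsSmoothSpaceTimeOn.sum fun j _ => (hR.column j).inner (hψI.partialDeriv hU j)
  have hAcont : ContinuousOn A I := hAsm.continuousOn_integral (convex_Icc 0 T)
  have hBcont : ContinuousOn B I := hBsm.continuousOn_integral (convex_Icc 0 T)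
  have hAint : IntegrableOn A (Ioo 0 T) volume :=
    (hAcont.integrableOn_compact isCompact_Icc).mono_set Ioo_subset_Icc_self
  have hBint : IntegrableOn B (Ioo 0 T) volume :=
    (hBcont.integrableOn_compact isCompact_Icc).mono_set Ioo_subset_Icc_self
  -- pointwise in time: `E' t = A t - B t` on `(0, T)`
  have hkey : ∀ t ∈ Ioo 0 T, E' t = A t - B t := by
    intro t ht
    have htI : t ∈ I := Ioo_subset_Icc_self ht
    have hvt : FunctionSpaces.Torus.IsSmooth (u t) := hv.isSmooth_slice htI
    have hpt : FunctionSpaces.Torus.IsSmooth (p t) := hp.isSmooth_slice htI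
    have hRt : FunctionSpaces.Torus.IsSmooth (R t) := hR.isSmooth_slice htI
    have hψt : FunctionSpaces.Torus.IsSmooth (ψ t) := hψI.isSmooth_slice htI
    have hψ't : FunctionSpaces.Torus.IsSmooth (FunctionSpaces.Torus.timeDeriv ψ t) := hψ.timeDeriv.isSmooth_slice t
    -- `∂ₜ⟪u, ψ⟫ = ⟪u, ∂ₜψ⟫ + ⟪νΔu + div R - ∇p - (u·∇)u, ψ⟫`
    have hslice : ∀ x, FunctionSpaces.Torus.timeDerivWithin I (fun t x => ⟪u t x, ψ t x⟫_ℝ) t x =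
        ⟪u t x, FunctionSpaces.Torus.timeDeriv ψ t x⟫_ℝ +
          ⟪ν • FunctionSpaces.Torus.laplacian (u t) x + tensorDivergence (R t) x - FunctionSpaces.Torus.gradient (p t) x -
            FunctionSpaces.Torus.convect (u t) (u t) x, ψ t x⟫_ℝ := by
      intro x
      have h1 : HasDerivWithinAt (fun τ => u τ x) (FunctionSpaces.Torus.timeDerivWithin I u t x) I t :=
        hv.hasDerivWithinAt_slice htI x
      have h2 : HasDerivWithinAt (fun τ => ψ τ x) (FunctionSpaces.Torus.timeDeriv ψ t x) I t := by
        obtain ⟨y, rfl⟩ := FunctionSpaces.Torus.proj_surjective x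
        have hd : Differentiable ℝ (fun τ : ℝ => FunctionSpaces.Torus.stLift ψ (τ, y)) :=
          (hψs.differentiable (by simp)).comp (differentiable_id.prodMk (differentiable_const y))
        exact (hd t).hasDerivAt.hasDerivWithinAt
      have h12 := (h1.inner ℝ h2).derivWithin (hU t htI)
      have hm := hI.momentum t htI x
      have h3 : FunctionSpaces.Torus.timeDerivWithin I u t x =
          ν • FunctionSpaces.Torus.laplacian (u t) x + tensorDivergence (R t) x - FunctionSpaces.Torus.gradient (p t) x -
            FunctionSpaces.Torus.convect (u t) (u t) x := by
        rw [← hm]; abel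
      rw [FunctionSpaces.Torus.timeDerivWithin, h12, h3]
    have i1 : Integrable (fun x => ⟪u t x, FunctionSpaces.Torus.timeDeriv ψ t x⟫_ℝ) volume :=
      (hvt.inner hψ't).integrable
    have i2 : Integrable (fun x => ⟪u t x, FunctionSpaces.Torus.convect (u t) (ψ t) x⟫_ℝ) volume :=
      (hvt.inner (hvt.convect hψt)).integrable
    have i12 : Integrable (fun x => ⟪u t x, FunctionSpaces.Torus.timeDeriv ψ t x⟫_ℝ +
        ⟪u t x, FunctionSpaces.Torus.convect (u t) (ψ t) x⟫_ℝ) volume := i1.add i2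
    have i3 : Integrable (fun x => ν * ⟪u t x, FunctionSpaces.Torus.laplacian (ψ t) x⟫_ℝ) volume :=
      ((hvt.inner hψt.laplacian).integrable).const_mul ν
    have iL : Integrable (fun x => ⟪ν • FunctionSpaces.Torus.laplacian (u t) x, ψ t x⟫_ℝ) volume :=
      ((hvt.laplacian.smul ν).inner hψt).integrable
    have iD : Integrable (fun x => ⟪tensorDivergence (R t) x, ψ t x⟫_ℝ) volume :=
      (hRt.tensorDivergence.inner hψt).integrable
    have iG : Integrable (fun x => ⟪FunctionSpaces.Torus.gradient (p t) x, ψ t x⟫_ℝ) volume :=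
      (hpt.gradient.inner hψt).integrable
    have iC : Integrable (fun x => ⟪FunctionSpaces.Torus.convect (u t) (u t) x, ψ t x⟫_ℝ) volume :=
      ((hvt.convect hvt).inner hψt).integrable
    have hlap : ∫ x, ⟪ν • FunctionSpaces.Torus.laplacian (u t) x, ψ t x⟫_ℝ =
        ∫ x, ν * ⟪u t x, FunctionSpaces.Torus.laplacian (ψ t) x⟫_ℝ := by
      simp_rw [real_inner_smul_left, integral_const_mul]
      rw [FunctionSpaces.Torus.integral_inner_laplacian_comm hvt hψt]
    have hgrad : ∫ x, ⟪FunctionSpaces.Torus.gradient (p t) x, ψ t x⟫_ℝ = 0 :=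
      FunctionSpaces.Torus.integral_inner_gradient_eq_zero_of_isDivFree hψt hpt (hψdiv t)
    have hconv : ∫ x, ⟪FunctionSpaces.Torus.convect (u t) (u t) x, ψ t x⟫_ℝ =
        -∫ x, ⟪u t x, FunctionSpaces.Torus.convect (u t) (ψ t) x⟫_ℝ :=
      FunctionSpaces.Torus.integral_inner_convect_eq_neg hvt (hI.divFree t htI) hvt hψt
    have hdivR : ∫ x, ⟪tensorDivergence (R t) x, ψ t x⟫_ℝ = -B t :=
      integral_inner_tensorDivergence hRt hψt
    have iLD : Integrable (fun x => ⟪ν • FunctionSpaces.Torus.laplacian (u t) x, ψ t x⟫_ℝ +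
        ⟪tensorDivergence (R t) x, ψ t x⟫_ℝ) volume := iL.add iD
    have iLDG : Integrable (fun x => ⟪ν • FunctionSpaces.Torus.laplacian (u t) x, ψ t x⟫_ℝ +
        ⟪tensorDivergence (R t) x, ψ t x⟫_ℝ - ⟪FunctionSpaces.Torus.gradient (p t) x, ψ t x⟫_ℝ) volume := iLD.sub iG
    have iLDGC : Integrable (fun x => ⟪ν • FunctionSpaces.Torus.laplacian (u t) x, ψ t x⟫_ℝ +
        ⟪tensorDivergence (R t) x, ψ t x⟫_ℝ - ⟪FunctionSpaces.Torus.gradient (p t) x, ψ t x⟫_ℝ -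
        ⟪FunctionSpaces.Torus.convect (u t) (u t) x, ψ t x⟫_ℝ) volume := iLDG.sub iC
    simp only [hE'_def, hA_def]
    simp_rw [hslice, inner_sub_left, inner_add_left]
    rw [integral_add i1 iLDGC, integral_sub iLDG iC, integral_sub iLD iG, integral_add iL iD,
      hgrad, hconv, hdivR, hlap, integral_add i12 i3, integral_add i1 i2]
    ring
  -- integrate in time
  have h0 : ∫ t in Ioo 0 T, (A t - B t) = -E 0 :=
    (setIntegral_congr_fun measurableSet_Ioo fun t ht => (hkey t ht).symm).trans hFTC
  have h1 : (∫ t in Ioo 0 T, A t) - ∫ t in Ioo 0 T, B t = -E 0 := by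
    rw [← integral_sub hAint hBint, h0]
  have h2 : (∫ t in Ioo 0 T, A t) + E 0 = ∫ t in Ioo 0 T, B t := by linarith
  exact h2

end NSR

/-! ## Well-preparedness (Cheskidov–Luo 2022, Def. 2.1) -/

section WellPrepared

omit [Fintype d] [DecidableEq d]

/-- **Well-preparedness of a Reynolds stress on `[0, T]`** (Cheskidov–Luo 2022, Def. 2.1: "a
smooth solution `(u, R)` of (2.1) on `[0,1]` is well-prepared if there exist a set `I` and a
length scale `τ > 0` such that `I` is a union of at most `τ^{-ε}` many closed intervals of length
`5τ` and `R(t, x) = 0` if `dist (t, Iᶜ) ≤ τ`"), with the set `I` and the scale `τ` as explicit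
arguments: `τ > 0`; `I = ⋃_{a ∈ s} [a, a + 5τ]` for a finite set `s` of left end-points with
`card s ≤ (T/τ)^ε`; and `R(t) = 0` for every `t ∈ [0, T]` with `Metric.infDist t Iᶜ ≤ τ`.
**Normalisation in `T`.** The source takes `T = 1` ("Throughout the paper, we take `T = 1` and
assume `0 < ε < 1` without loss of generality", §2.5), where the bound reads `card ≤ τ^{-ε}`
verbatim; on `[0, T]` we normalise the count by `T` (`(T/τ)^ε`), the form under which the start
of the iteration in the proof of Thm. 1.7 (§2.6: "`(u₀, R₀)` … is well-prepared", i.e. with no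
constraint on `R₀`) exists for every `T > 0` (`Torus.isWellPrepared_Icc`) and which the
concentration step (Prop. 3.1, subdividing `[0, T]` into intervals of length `T^{1-ε} τ^ε`)
reproduces. Only the property `card ≤ C τ^{-ε}` with `C` independent of the step enters the
dimension count of §2.6. [cite: CheskidovLuo2022, Def. 2.1] -/
structure IsWellPrepared (T ε : ℝ) (R : ℝ → UnitAddTorus d → d → EuclideanSpace ℝ d)
    (I : Set ℝ) (τ : ℝ) : Prop where
  /-- The length scale is positive. -/
  pos : 0 < τ
  /-- `I` is a union of at most `(T/τ)^ε` closed intervals of length `5τ`. -/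
  exists_finset : ∃ s : Finset ℝ, (s.card : ℝ) ≤ (T / τ) ^ ε ∧ I = ⋃ a ∈ s, Icc a (a + 5 * τ)
  /-- The stress vanishes at every time of `[0, T]` within distance `τ` of the complement of
  `I` (in particular off `I`). -/
  stress_eq_zero : ∀ t ∈ Icc 0 T, Metric.infDist t Iᶜ ≤ τ → ∀ x, R t x = 0

variable {T ε τ : ℝ} {R : ℝ → UnitAddTorus d → d → EuclideanSpace ℝ d} {I : Set ℝ}

/-- The set of a well-prepared configuration is closed (a finite union of closed intervals). [folklore] -/
theorem IsWellPrepared.isClosed (h : IsWellPrepared T ε R I τ) : IsClosed I := by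
  obtain ⟨s, -, rfl⟩ := h.exists_finset
  exact isClosed_biUnion_finset fun a _ => isClosed_Icc

/-- Off the set `I`, the stress of a well-prepared configuration vanishes on `[0, T]`
(`infDist t Iᶜ = 0 ≤ τ`; CL22, Rem. 2.3 (3)). [cite: CheskidovLuo2022, Def. 2.1] -/
theorem IsWellPrepared.stress_eq_zero_of_not_mem (h : IsWellPrepared T ε R I τ) {t : ℝ}
    (ht : t ∈ Icc 0 T) (htI : t ∉ I) (x : UnitAddTorus d) : R t x = 0 :=
  h.stress_eq_zero t ht (by rw [Metric.infDist_zero_of_mem (show t ∈ Iᶜ from htI)]; exact h.pos.le) x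

/-- Within distance `τ` of a time `s ∉ I`, the stress of a well-prepared configuration vanishes
on `[0, T]` (`infDist t Iᶜ ≤ dist t s`). [cite: CheskidovLuo2022, Def. 2.1] -/
theorem IsWellPrepared.stress_eq_zero_of_dist_le (h : IsWellPrepared T ε R I τ) {t s : ℝ}
    (ht : t ∈ Icc 0 T) (hs : s ∉ I) (hts : dist t s ≤ τ) (x : UnitAddTorus d) : R t x = 0 :=
  h.stress_eq_zero t ht ((Metric.infDist_le_dist_of_mem (show s ∈ Iᶜ from hs)).trans hts) x

/-- **The vacuous well-prepared configuration that starts the iteration**: for `T > 0`, every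
stress is well-prepared on `[0, T]` for the single interval `I = [-2T, 3T]` (of length `5T`,
`1 ≤ (T/T)^ε` intervals) and the scale `τ = T`, because every `t ∈ [0, T]` has distance `≥ 2T`
from `Iᶜ` (CL22, §2.6, proof of Thm. 1.7: "`(u₀, R₀)` solves (2.1) trivially and is
well-prepared", the step `n = 0` where nothing is required of `R₀`). [cite: CheskidovLuo2022, §2.6 (proof of Thm. 1.7)] -/
theorem isWellPrepared_Icc (hT : 0 < T) (ε : ℝ) (R : ℝ → UnitAddTorus d → d → EuclideanSpace ℝ d) :
    IsWellPrepared T ε R (Icc (-(2 * T)) (3 * T)) T where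
  pos := hT
  exists_finset := by
    refine ⟨{-(2 * T)}, ?_, ?_⟩
    · rw [Finset.card_singleton, div_self hT.ne', Real.one_rpow, Nat.cast_one]
    · rw [Finset.set_biUnion_singleton]
      congr 1
      ring
  stress_eq_zero t ht hdist x := by
    exfalso
    have hne : (Icc (-(2 * T)) (3 * T))ᶜ.Nonempty := ⟨4 * T, fun h => by linarith [h.2]⟩
    obtain ⟨y, hy, hty⟩ :=
      (Metric.infDist_lt_iff hne).1 (hdist.trans_lt (by linarith : T < 2 * T))
    rw [mem_compl_iff, mem_Icc, not_and_or, not_le, not_le] at hy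
    rw [Real.dist_eq] at hty
    have h1 := abs_lt.1 hty
    rcases hy with hy | hy
    · linarith [ht.1, h1.2]
    · linarith [ht.2, h1.1]

end WellPrepared

/-! ## Two named facts: the antidivergence `ℛ` and the main iteration (Prop. 2.2) -/

section Facts

/-- **The tensor-valued antidivergence on `T^d` (named fact).** In dimension `card d ≥ 2`: for
every time-dependent vector field `f` jointly smooth on `[0, T] × T^d` and of zero spatial mean
at each `t ∈ [0, T]`, there is a symmetric, trace-free `2`-tensor field `R` (stored by columns),
jointly smooth on `[0, T] × T^d`, with `div R(t) = f(t)` pointwise for every `t ∈ [0, T]`.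
This is the operator `ℛ : C^∞(𝕋^d, ℝ^d) → C^∞(𝕋^d, 𝒮₀^{d×d})` of De Lellis–Székelyhidi recalled
in Cheskidov–Luo 2022, §7.2 (= App. B), Def. 7.2, a Fourier multiplier of order `-1` built from
`Δ⁻¹` and `∂ᵢ` ("`ℛ` is well-defined since `ℛᵢⱼₖ` is symmetric in `i,j` and taking the trace
gives `0`"; "`div (ℛ v) = v - ⨍ v` for any `v ∈ C^∞(𝕋^d, ℝ^d)`"), applied slice-wise in time —
as in the first line of the proof of Thm. 1.7 (§2.6), `R₀ = ℛ(∂ₜu₀ - Δu₀ + div (u₀ ⊗ u₀))`,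
where joint smoothness of `ℛ` of a jointly smooth field is used. Only existence is recorded (the
printed formula for `ℛᵢⱼₖ` is not needed downstream). Not available in Mathlib/this library (no
inverse Laplacian on `UnitAddTorus`). [cite: CheskidovLuo2022, §7.2 Def. 7.2] -/
def exists_smooth_antidivergence : Prop :=
  2 ≤ Fintype.card d → ∀ (T : ℝ) (f : ℝ → UnitAddTorus d → EuclideanSpace ℝ d),
    FunctionSpaces.Torus.IsSmoothSpaceTimeOn (Icc 0 T) f → (∀ t ∈ Icc 0 T, FunctionSpaces.Torus.HasZeroMean (f t)) →
    ∃ R : ℝ → UnitAddTorus d → d → EuclideanSpace ℝ d,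
      FunctionSpaces.Torus.IsSmoothSpaceTimeOn (Icc 0 T) R ∧
      (∀ t ∈ Icc 0 T, ∀ x, ∀ i j : d, R t x i j = R t x j i) ∧
      (∀ t ∈ Icc 0 T, ∀ x, ∑ i, R t x i i = 0) ∧
      ∀ t ∈ Icc 0 T, ∀ x, tensorDivergence (R t) x = f t x

/-- **Cheskidov–Luo 2022, Prop. 2.2 (Main iteration), named fact — in the form its proof
delivers.** Printed (for `T = 1`, viscosity `1`, `d ≥ 2`): "For any `ε > 0` and `p < 2`, there
exists a universal constant `M = M(ε, p) > 0` and `r > 1` depending only on `p` and `q` such that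
the following holds. Let `δ > 0` and `(u, R)` be a well-prepared smooth solution of (2.1) for some
set `Ĩ` and a length scale `τ̃ > 0`. Then there exists another well-prepared smooth solution
`(u₁, R₁)` of (2.1) for some set `I ⊂ Ĩ` with `0, 1 ∉ I` and `τ < τ̃/2` such that
`‖R₁‖_{L¹(0,1;Lʳ)} ≤ δ`. Moreover, the velocity perturbation `w := u₁ - u` satisfies
(1) `Supp w ⊂ I × 𝕋^d`; (2) `‖w‖_{L²([0,1] × 𝕋^d)} ≤ M ‖R‖_{L¹([0,1] × 𝕋^d)}`;
(3) `‖w‖_{L^p(0,1;L^∞)} + ‖w‖_{L¹(0,1;W^{1,q})} ≤ δ`."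
**Rendering.** `d` any finite index type with `card d ≥ 2`; time interval `[0, T]`, `T > 0`
(print: `T = 1` "without loss of generality", §2.5), `0 < ε < 1` (ibid.), `1 ≤ p < 2`; smooth
solutions are `Torus.IsNSReynoldsOn (Icc 0 T) 1` triples with zero-mean velocity (the paper's
standing convention, §1.1/§1.7), well-preparedness is `Torus.IsWellPrepared` (Def. 2.1, count
normalised by `T`); norms are the accepted mixed norms `Torus.eLqLpNorm` over `(0, T)`; the
`W^{1,q}` half of (3) is not rendered (no `W^{1,q}(𝕋^d)` vocabulary; dropping it weakens the
fact). **Two clauses are stated as proved in §§3–5 rather than as worded in Prop. 2.2:**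
(1) the temporal support: Prop. 3.1 gives `Supp w̄ ⊂ Ĩ × 𝕋^d` for the concentration corrector
and Prop. 4.1/Lemma 4.6 give `Supp ⊂ I ⊂ Ĩ` for the convex-integration perturbation, so what is
proved (and what §2.6 uses: "`w_k ≡ 0` on `𝓑ₙᶜ` for all `k > n`") is `u₁ = u` at the times of
`[0, T]` outside the INPUT set `Ĩ`, together with `u₁(0) = u(0)` (the correctors start from zero
data, `vᵢ(tᵢ) = 0` in (3.2), and `0 ∉ I`; used in §2.6 as "`uₙ(0, x) ≡ v(0, x)` for all `n`") —
the literal `Supp w ⊂ I` with the new `I ∌ 0` would force the input to solve Navier–Stokes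
exactly near `t = 0`; (2) the `L²` estimate: Props. 5.3–5.5 prove
`‖w‖_{L²_{t,x}} ≲ ‖R̄‖_{L¹_{t,x}}^{1/2}` (square root; with `‖R̄‖_{L¹Lʳ} ≤ C(r,ε) ‖R‖_{L¹Lʳ}`,
Prop. 3.3, and the corrector `w̄` as small as desired, Prop. 3.1), so the estimate is rendered as
`‖u₁ - u‖_{L²(0,T;L²)} ≤ M ‖R‖_{L¹(0,T;Lʳ)}^{1/2}`; the proof of Thm. 1.7 in §2.6 only needs
summability of these bounds along `δₙ = 2⁻ⁿ ε`, which both forms give. The Reynolds stress is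
measured in the column-sup norm of `Torus.IsEulerReynoldsOn` (all matrix norms are equivalent;
constants absorbed in `M`, `r`, `δ`). The proof (§§3–5: local well-posedness of the generalised
Navier–Stokes system on short intervals, sharp temporal cut-offs, intermittent space–time convex
integration with stationary Mikado flows) is not formalised. [cite: CheskidovLuo2022, Prop. 2.2] -/
def CheskidovLuo2022MainIteration : Prop :=
  2 ≤ Fintype.card d → ∀ (T : ℝ), 0 < T → ∀ (ε : ℝ), 0 < ε → ε < 1 → ∀ (p : ℝ), 1 ≤ p → p < 2 →
    ∃ M : ℝ, 0 < M ∧ ∃ r : ℝ, 1 < r ∧ ∀ (δ : ℝ), 0 < δ →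
      ∀ (u : ℝ → UnitAddTorus d → EuclideanSpace ℝ d) (P : ℝ → UnitAddTorus d → ℝ)
        (R : ℝ → UnitAddTorus d → d → EuclideanSpace ℝ d) (I₀ : Set ℝ) (τ₀ : ℝ),
        IsNSReynoldsOn (Icc 0 T) 1 u P R → (∀ t ∈ Icc 0 T, FunctionSpaces.Torus.HasZeroMean (u t)) →
        IsWellPrepared T ε R I₀ τ₀ →
        ∃ (u₁ : ℝ → UnitAddTorus d → EuclideanSpace ℝ d) (P₁ : ℝ → UnitAddTorus d → ℝ)
          (R₁ : ℝ → UnitAddTorus d → d → EuclideanSpace ℝ d) (I : Set ℝ) (τ : ℝ),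
          IsNSReynoldsOn (Icc 0 T) 1 u₁ P₁ R₁ ∧ (∀ t ∈ Icc 0 T, FunctionSpaces.Torus.HasZeroMean (u₁ t)) ∧
          IsWellPrepared T ε R₁ I τ ∧ I ⊆ I₀ ∧ (0 : ℝ) ∉ I ∧ T ∉ I ∧ τ < τ₀ / 2 ∧
          eLqLpNorm 1 (ENNReal.ofReal r) R₁ (Ioo 0 T) ≤ ENNReal.ofReal δ ∧
          (∀ t ∈ Icc 0 T, t ∉ I₀ → u₁ t = u t) ∧ u₁ 0 = u 0 ∧
          eLqLpNorm 2 2 (fun t x => u₁ t x - u t x) (Ioo 0 T) ≤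
            ENNReal.ofReal M * eLqLpNorm 1 (ENNReal.ofReal r) R (Ioo 0 T) ^ (1 / 2 : ℝ) ∧
          eLqLpNorm (ENNReal.ofReal p) ∞ (fun t x => u₁ t x - u t x) (Ioo 0 T) ≤
            ENNReal.ofReal δ

end Facts

end Torus

/-! ## Hausdorff dimension of sets with covers by few short intervals -/

section Hausdorff

/-- **Sets covered by `≲ ℓ^{-ε}` intervals of length `ℓ → 0` have Hausdorff dimension `≤ ε`.**
If `ε ≥ 0` and, along a sequence of scales `ℓₙ > 0` with `ℓₙ → 0`, the set `s ⊆ ℝ` is covered by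
the intervals `[a, a + ℓₙ]`, `a ∈ cₙ`, for finite sets `cₙ` with `card cₙ ≤ A ℓₙ^{-ε}`, then
`dimH s ≤ ε`: for `d' > ε` the `d'`-dimensional Hausdorff measure is at most
`liminf ∑ diam^{d'} ≤ liminf A ℓₙ^{d'-ε} = 0` (Mathlib's `hausdorffMeasure_le_liminf_sum`). This is
the last step of the proof of Cheskidov–Luo 2022, Thm. 1.7 (§2.6: "Since each `𝓑ₙ` is covered by
at most `τₙ^{-ε}` many balls of radius `5τₙ`, we have `d_𝓗(limsup 𝓑ₙ) ≤ ε`"). [cite: CheskidovLuo2022, §2.6 (proof of Thm. 1.7)] -/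
theorem dimH_le_of_finset_Icc_covers {s : Set ℝ} {ε A : ℝ} (hε : 0 ≤ ε) (ℓ : ℕ → ℝ)
    (hℓ : ∀ n, 0 < ℓ n) (hℓ0 : Tendsto ℓ atTop (𝓝 0)) (c : ℕ → Finset ℝ)
    (hcard : ∀ n, ((c n).card : ℝ) ≤ A * (ℓ n) ^ (-ε))
    (hcover : ∀ n, s ⊆ ⋃ a ∈ c n, Icc a (a + ℓ n)) :
    dimH s ≤ ENNReal.ofReal ε := by
  refine dimH_le fun d' hd' => ?_
  rcases le_or_gt (d' : ℝ≥0∞) (ENNReal.ofReal ε) with hle | hlt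
  · exact hle
  exfalso
  -- `ε < d'`
  have hεd : ε < d' := by
    rw [← ENNReal.ofReal_coe_nnreal] at hlt
    exact (ENNReal.ofReal_lt_ofReal_iff_of_nonneg hε).1 hlt
  -- the Hausdorff measure bound along the covers
  have key : μH[(d' : ℝ)] s ≤
      liminf (fun n => ∑ i : c n, Metric.ediam (Icc (i : ℝ) (i + ℓ n)) ^ (d' : ℝ)) atTop := by
    refine Measure.hausdorffMeasure_le_liminf_sum (d' : ℝ) s (fun n => ENNReal.ofReal (ℓ n)) ?_
      (fun n (i : c n) => Icc (i : ℝ) (i + ℓ n)) ?_ ?_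
    · rw [← ENNReal.ofReal_zero]
      exact ENNReal.tendsto_ofReal hℓ0
    · refine Eventually.of_forall fun n i => ?_
      rw [Real.ediam_Icc, add_sub_cancel_left]
    · refine Eventually.of_forall fun n x hx => ?_
      have h := hcover n hx
      rw [mem_iUnion₂] at h
      obtain ⟨a, ha, hxa⟩ := h
      exact mem_iUnion.2 ⟨⟨a, ha⟩, hxa⟩
  -- the sums are `card (c n) · ℓₙ^{d'}`
  have hsum : ∀ n, ∑ i : c n, Metric.ediam (Icc (i : ℝ) (i + ℓ n)) ^ (d' : ℝ) =
      ENNReal.ofReal ((c n).card * (ℓ n) ^ (d' : ℝ)) := by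
    intro n
    have h1 : ∀ i : c n, Metric.ediam (Icc (i : ℝ) (i + ℓ n)) ^ (d' : ℝ) =
        ENNReal.ofReal ((ℓ n) ^ (d' : ℝ)) := by
      intro i
      rw [Real.ediam_Icc, add_sub_cancel_left, ENNReal.ofReal_rpow_of_pos (hℓ n)]
    simp_rw [h1]
    rw [Finset.sum_const, Finset.card_univ, Fintype.card_coe, nsmul_eq_mul,
      ENNReal.ofReal_mul (Nat.cast_nonneg _), ENNReal.ofReal_natCast]
  -- and they tend to zero since `d' > ε`
  have hlim : Tendsto (fun n => ENNReal.ofReal ((c n).card * (ℓ n) ^ (d' : ℝ))) atTop (𝓝 0) := by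
    rw [← ENNReal.ofReal_zero]
    refine ENNReal.tendsto_ofReal ?_
    have hup : Tendsto (fun n => A * (ℓ n) ^ ((d' : ℝ) - ε)) atTop (𝓝 0) := by
      have h0 : Tendsto (fun n => (ℓ n) ^ ((d' : ℝ) - ε)) atTop (𝓝 0) := by
        have := hℓ0.rpow_const (p := (d' : ℝ) - ε) (Or.inr (by linarith))
        rwa [Real.zero_rpow (by linarith)] at this
      simpa using h0.const_mul A
    refine tendsto_of_tendsto_of_tendsto_of_le_of_le tendsto_const_nhds hup
      (fun n => mul_nonneg (Nat.cast_nonneg _) (Real.rpow_nonneg (hℓ n).le _)) fun n => ?_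
    calc ((c n).card : ℝ) * (ℓ n) ^ (d' : ℝ)
        ≤ A * (ℓ n) ^ (-ε) * (ℓ n) ^ (d' : ℝ) :=
          mul_le_mul_of_nonneg_right (hcard n) (Real.rpow_nonneg (hℓ n).le _)
      _ = A * (ℓ n) ^ ((d' : ℝ) - ε) := by
          rw [mul_assoc, ← Real.rpow_add (hℓ n)]
          ring_nf
  have hzero : μH[(d' : ℝ)] s = 0 := by
    refine le_antisymm ?_ (zero_le)
    calc μH[(d' : ℝ)] s
        ≤ liminf (fun n => ∑ i : c n, Metric.ediam (Icc (i : ℝ) (i + ℓ n)) ^ (d' : ℝ)) atTop := key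
      _ = liminf (fun n => ENNReal.ofReal ((c n).card * (ℓ n) ^ (d' : ℝ))) atTop := by
          simp_rw [hsum]
      _ = 0 := hlim.liminf_eq
  exact ENNReal.zero_ne_top (hzero.symm.trans hd')

end Hausdorff

end Literature.Analysis.FluidPDE
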